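import Literature.Computability.Complexity.BinarySearchPP
import HarnessLib

/-!
# Binary search against an unreliable oracle: the claimed value and its two certificates

Topic `Computability/MetaComplexity` (refuters and constructive separations, Chen–Jin–Santhanam–
Williams, *Constructive separations and their consequences*, FOCS 2021 / TheoretiCS 2024
[ChenEtAl2022], §5.3, proof of Thm. 6 = Thm. 1.2 for `𝒟 = PP`).

The refuter of [ChenEtAl2022, §5.3] runs the textbook `P^{PP}` binary search for a witness count
(Arora–Barak 2009, proof of Lemma 17.7; in the tree `BinarySearchPP.lean`, whose threshold numerals
`BinSearchPP.qryNum D a = 1^{D-1-|a|} 0 aᴿ` we reuse) but with the `PP` oracle REPLACED by the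
algorithm `A` under refutation, whose answers need not be truthful. This file isolates what such a
search yields against an ARBITRARY answer predicate `ans : {0,1}* → Bool` on width-`D` numerals:

* `bsBits D ans k` — the first `k` answer bits (most significant digit first), `bsVal D ans` — the
  claimed value, `< 2^D` (`bsVal_lt_two_pow`);
* the two certificates the printed proof reads off the transcript ("`D^{PP}` must have asked the
  query `#SAT(φ) ≥ Σ cⱼ2ʲ` … and the oracle answers `1`"; "… the query `≥ 1 + Σ cⱼ2ʲ`, to which the
  oracle answered `0`", [ChenEtAl2022, §5.3]): if the claimed value `g` is positive, `ans` said YES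
  on the numeral of `g - 1` (`ans_natBits_pred_of_pos` — it claims "count `> g - 1`"); if
  `g < 2^D - 1`, `ans` said NO on the numeral of `g` (`ans_natBits_of_lt` — it claims
  "count `≤ g`"). Both queries are identified as the canonical width-`D` little-endian numerals
  `natBits D ·`, so a consumer can rebuild them arithmetically from `g`;
* `bsBits_congr` — the transcript only depends on `ans` at strings of length `D`.

Pure list arithmetic; no machines here (the query generator in `FP` is assembled downstream).

## References

* L. Chen, C. Jin, R. Santhanam, R. Williams, *Constructive separations and their consequences*,
  FOCS 2021 = TheoretiCS 3 (2024), §5.3 (proof of Thm. 6) [ChenEtAl2022].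
* S. Arora, B. Barak, *Computational Complexity: A Modern Approach*, CUP 2009, §17.2.1, proof of
  Lemma 17.7 (binary search with `PP` questions) [AroraBarak2009].
-/

namespace Literature.Computability.MetaComplexity

open Literature.Computability.Complexity Literature.Computability.Complexity.BinSearchPP
  Literature.Computability.Complexity.CoinEnum

namespace PPRefuter

/-! ### The transcript of the search -/

/-- **The answer bits of the width-`D` binary search against the answer predicate `ans`**, most
significant digit first: the `(k+1)`-st bit is `ans` on the threshold numeral `qryNum D (first k bits)`.
[cite: ChenEtAl2022, §5.3 (proof of Thm. 6: the algorithm `D^{A}`)] -/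
def bsBits (D : ℕ) (ans : List Bool → Bool) : ℕ → List Bool
  | 0 => []
  | k + 1 => bsBits D ans k ++ [ans (qryNum D (bsBits D ans k))]

/-- **The claimed value**: the `D` answer bits read as a binary numeral, most significant first.
[cite: ChenEtAl2022, §5.3 (proof of Thm. 6: `D^{A}(φ)`)] -/
def bsVal (D : ℕ) (ans : List Bool → Bool) : ℕ := bitsToNat (bsBits D ans D).reverse

variable {D : ℕ} {ans : List Bool → Bool}

/-- `bsBits … 0 = []`. [folklore] -/
@[simp] theorem bsBits_zero : bsBits D ans 0 = [] := rfl

/-- One more answer bit. [folklore] -/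
theorem bsBits_succ (k : ℕ) : bsBits D ans (k + 1) = bsBits D ans k ++ [ans (qryNum D (bsBits D ans k))] := rfl

/-- `bsBits … k` has `k` entries. [folklore] -/
@[simp] theorem length_bsBits : ∀ k, (bsBits D ans k).length = k
  | 0 => rfl
  | k + 1 => by rw [bsBits_succ, List.length_append, length_bsBits k, List.length_singleton]

/-- Earlier answer bits are a prefix of later ones. [folklore] -/
theorem bsBits_take {i j : ℕ} (h : i ≤ j) : (bsBits D ans j).take i = bsBits D ans i := by
  induction j with
  | zero => obtain rfl : i = 0 := Nat.le_zero.1 h; rfl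
  | succ j ih =>
    rcases Nat.lt_or_eq_of_le h with hlt | rfl
    · rw [bsBits_succ, List.take_append_of_le_length (by rw [length_bsBits]; omega)]
      exact ih (by omega)
    · rw [List.take_of_length_le (by rw [length_bsBits])]

/-- The numeral asked after `a` has width `D` (for `|a| < D`). [folklore] -/
theorem length_qryNum {a : List Bool} (ha : a.length < D) : (qryNum D a).length = D := by
  simp [qryNum]; omega

/-- Value of the numeral asked after `a`: `2ʲ - 1 + 2ʲ⁺¹·val(aᴿ)`, `j = D - 1 - |a|`. [folklore] -/
theorem bitsToNat_qryNum (a : List Bool) :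
    bitsToNat (qryNum D a) = 2 ^ (D - 1 - a.length) - 1 + 2 ^ (D - 1 - a.length + 1) * bitsToNat a.reverse := by
  rw [qryNum, bitsToNat_append, bitsToNat_replicate_true, List.length_replicate, bitsToNat_cons]
  simp [pow_succ]; ring

/-- The claimed value is below `2^D`. [folklore] -/
theorem bsVal_lt_two_pow : bsVal D ans < 2 ^ D := by
  have h := bitsToNat_lt (bsBits D ans D).reverse
  rw [List.length_reverse, length_bsBits] at h
  exact h

/-- Bit `k` of the full transcript is the answer on the numeral built from the first `k` bits. [folklore] -/
theorem bsBits_decomp {k : ℕ} (hk : k < D) :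
    ∃ c, bsBits D ans D = bsBits D ans k ++ ans (qryNum D (bsBits D ans k)) :: c ∧ c.length = D - 1 - k := by
  refine ⟨(bsBits D ans D).drop (k + 1), ?_, by simp; omega⟩
  have h1 : (bsBits D ans D).take (k + 1) = bsBits D ans k ++ [ans (qryNum D (bsBits D ans k))] := by
    rw [bsBits_take (by omega), bsBits_succ]
  calc bsBits D ans D = (bsBits D ans D).take (k + 1) ++ (bsBits D ans D).drop (k + 1) :=
        (List.take_append_drop _ _).symm
    _ = _ := by rw [h1, List.append_assoc]; rfl

/-- A string of length `D` is the canonical numeral of its value. [folklore] -/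
theorem eq_natBits_of_length {v : List Bool} (hl : v.length = D) : v = natBits D (bitsToNat v) := by
  rw [← hl, natBits_bitsToNat]

/-! ### Locating the last `1` and the last `0` -/

/-- A Boolean string containing `b` ends in `b` followed by copies of `!b`. [folklore] -/
theorem exists_eq_append_cons_replicate {l : List Bool} {b : Bool} (h : b ∈ l) :
    ∃ a j, l = a ++ b :: List.replicate j (!b) := by
  induction l using List.reverseRecOn with
  | nil => simp at h
  | append_singleton l c ih =>
    by_cases hc : c = b
    · subst hc; exact ⟨l, 0, by simp⟩
    · have hcb : c = !b := by cases c <;> cases b <;> simp_all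
      have hb : b ∈ l := by simpa [Ne.symm hc, hc] using h
      obtain ⟨a, j, rfl⟩ := ih hb
      exact ⟨a, j + 1, by rw [hcb, List.replicate_succ', List.append_assoc]; rfl⟩

/-- If the transcript is `a ++ b :: c` then `a` are the first `|a|` answers and `b` is the answer on
`qryNum D a`. [folklore] -/
theorem ans_of_eq_append {a c : List Bool} {b : Bool} (h : bsBits D ans D = a ++ b :: c) :
    bsBits D ans a.length = a ∧ ans (qryNum D a) = b := by
  have hD : a.length + 1 + c.length = D := by
    have := congrArg List.length h; simp at this; omega
  have hk : a.length < D := by omega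
  obtain ⟨c', hc', -⟩ := bsBits_decomp (ans := ans) hk
  have ha : bsBits D ans a.length = a := by
    have := congrArg (List.take a.length) h
    rwa [bsBits_take hk.le, List.take_append_of_le_length le_rfl, List.take_length] at this
  refine ⟨ha, ?_⟩
  rw [ha] at hc'
  rw [hc'] at h
  have := List.append_cancel_left h
  exact (List.cons.inj this).1

/-! ### The two certificates -/

/-- **The YES certificate.** If the claimed value `g` is positive then the oracle answered YES on
the width-`D` numeral of `g - 1`, i.e. it claimed "the count exceeds `g - 1`". (The last `1` of the
transcript was given on exactly this numeral.) [cite: ChenEtAl2022, §5.3 (proof of Thm. 6)] -/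
theorem ans_natBits_pred_of_pos (h : 0 < bsVal D ans) : ans (natBits D (bsVal D ans - 1)) = true := by
  have hmem : true ∈ bsBits D ans D := by
    by_contra hno
    have hall : bsBits D ans D = List.replicate D false :=
      List.eq_replicate_iff.2 ⟨length_bsBits D, fun b hb => by
        cases b
        · rfl
        · exact absurd hb hno⟩
    simp [bsVal, hall] at h
  obtain ⟨a, j, hdec⟩ := exists_eq_append_cons_replicate hmem
  obtain ⟨-, hans⟩ := ans_of_eq_append hdec
  have hD : a.length + 1 + j = D := by
    have := congrArg List.length hdec; simp at this; omega
  -- the value of the transcript and of the query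
  have hval : bsVal D ans = 2 ^ j + 2 ^ (j + 1) * bitsToNat a.reverse := by
    rw [bsVal, hdec]
    simp [List.reverse_append, bitsToNat_append, pow_succ]; ring
  have hq : bitsToNat (qryNum D a) = bsVal D ans - 1 := by
    rw [bitsToNat_qryNum, hval, show D - 1 - a.length = j by omega]
    have : 1 ≤ 2 ^ j := Nat.one_le_two_pow
    omega
  have hlen : (qryNum D a).length = D := length_qryNum (by omega)
  rw [← hans, eq_natBits_of_length hlen, hq]

/-- **The NO certificate.** If the claimed value `g` is below `2^D - 1` then the oracle answered NO
on the width-`D` numeral of `g`, i.e. it claimed "the count is at most `g`". (The last `0` of the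
transcript was given on exactly this numeral.) [cite: ChenEtAl2022, §5.3 (proof of Thm. 6)] -/
theorem ans_natBits_of_lt (h : bsVal D ans < 2 ^ D - 1) : ans (natBits D (bsVal D ans)) = false := by
  have hmem : false ∈ bsBits D ans D := by
    by_contra hno
    have hall : bsBits D ans D = List.replicate D true :=
      List.eq_replicate_iff.2 ⟨length_bsBits D, fun b hb => by
        cases b
        · exact absurd hb hno
        · rfl⟩
    have : bsVal D ans = 2 ^ D - 1 := by
      rw [bsVal, hall, List.reverse_replicate, bitsToNat_replicate_true]
    omega
  obtain ⟨a, j, hdec⟩ := exists_eq_append_cons_replicate hmem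
  obtain ⟨-, hans⟩ := ans_of_eq_append hdec
  have hD : a.length + 1 + j = D := by
    have := congrArg List.length hdec; simp at this; omega
  have hval : bsVal D ans = 2 ^ j - 1 + 2 ^ (j + 1) * bitsToNat a.reverse := by
    rw [bsVal, hdec]
    simp [List.reverse_append, bitsToNat_append, bitsToNat_replicate_true, pow_succ]; ring
  have hq : bitsToNat (qryNum D a) = bsVal D ans := by
    rw [bitsToNat_qryNum, hval, show D - 1 - a.length = j by omega]
  have hlen : (qryNum D a).length = D := length_qryNum (by omega)
  rw [← hans, eq_natBits_of_length hlen, hq]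

/-! ### Dependence on the oracle -/

/-- **The transcript only depends on the answers at length `D`.** [folklore] -/
theorem bsBits_congr {ans' : List Bool → Bool} (h : ∀ s : List Bool, s.length = D → ans s = ans' s) :
    ∀ k ≤ D, bsBits D ans k = bsBits D ans' k
  | 0, _ => rfl
  | k + 1, hk => by
    rw [bsBits_succ, bsBits_succ, bsBits_congr h k (by omega), h _ (length_qryNum (by simp; omega))]

/-- The claimed value only depends on the answers at length `D`. [folklore] -/
theorem bsVal_congr {ans' : List Bool → Bool} (h : ∀ s : List Bool, s.length = D → ans s = ans' s) :
    bsVal D ans = bsVal D ans' := by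
  rw [bsVal, bsVal, bsBits_congr h D le_rfl]

/-! ### The truthful oracle -/

/-- **Against the truthful oracle the search finds the count**: if `ans s = [val s < S]` for every
width-`D` numeral `s` and `S < 2^D`, the claimed value is `S`. (Arora–Barak's invariant, in the tree
`BinSearchPP.qryNum_lt_iff`.) [cite: AroraBarak2009, Lemma 17.7 (proof)] -/
theorem bsVal_eq_of_truthful {S : ℕ} (hS : S < 2 ^ D)
    (h : ∀ s : List Bool, s.length = D → ans s = decide (bitsToNat s < S)) : bsVal D ans = S := by
  have key : ∀ k ≤ D, bsBits D ans k = (msb D S).take k := by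
    intro k
    induction k with
    | zero => intro; simp
    | succ k ih =>
      intro hk
      rw [bsBits_succ, ih (by omega), List.take_succ_eq_append_getElem (by simp; omega)]
      congr 1
      rw [List.singleton_inj, h _ (length_qryNum (by simp; omega))]
      by_cases hb : (msb D S)[k]'(by simp; omega) = true
      · rw [hb, decide_eq_true_eq]; exact (qryNum_lt_iff hS (by omega)).2 hb
      · rw [Bool.not_eq_true] at hb
        rw [hb, decide_eq_false_iff_not]
        exact fun hlt => by rw [(qryNum_lt_iff hS (by omega)).1 hlt] at hb; exact Bool.noConfusion hb
  rw [bsVal, key D le_rfl, List.take_of_length_le (by simp), msb, List.reverse_reverse, bitsToNat_natBits hS]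

end PPRefuter

end Literature.Computability.MetaComplexity
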